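import Summits.AtomisticToContinuum.Crystallization.Theorems.ReggeStarCoercivityDefectFreeCrystallizesDevelopmentSteps1
import Summits.AtomisticToContinuum.Crystallization.Theorems.ReggeStarCoercivityDefectFreeCrystallizesDevelopmentGlobalA
import Summits.AtomisticToContinuum.Crystallization.Theorems.ReggeStarCoercivityDefectFreeCrystallizesDevelopmentGlobalB
import Summits.AtomisticToContinuum.Crystallization.Theorems.PalmUnimodularRigidityShellsToBarlowChartTransportGlobalC

/-!
# All layers of the development (port to the abstract `1/20` chart clauses)

Port of `Theorems/PalmUnimodularRigidityShellsToBarlowChartTransportGlobalC.lean` (crux 9227, line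
`develop-the-model-growth-descent`) to the ABSTRACT chart clauses of line `palm-good-law` of crux
stmt-AtomisticToContinuum-13603 (stub R1a4 `stub_combinatorialDevelopment`): the integer-chart hypothesis
`hch : ∀ z ∈ S, IsZChart S z …` is replaced by the section hypothesis `hch` = (pattern `fcc3Int`/`hcpInt`,
labelling `nb z` bijective onto the bonded neighbours, exact links) at every site ∧ the transfer identity for
every bonded pair; statements and proofs are otherwise verbatim (the transports `Istep, …, frameAt` and the
pattern facts `TransportPatterns*` are reused by name).  All `[folklore]` (HalesDSP2012 §1.3).
-/

noncomputable section

namespace Summit.AtomisticToContinuum.Crystallization.Theorems.PalmGoodLaw.Development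

open Literature.Geometry.DiscreteGeometry Literature.MathematicalPhysics.StatisticalMechanics
open Summit.AtomisticToContinuum.Crystallization.Theorems.ShellsToBarlowChartNegative
open Summit.AtomisticToContinuum.Crystallization.Theorems.PalmUnimodularRigidityShellsToBarlowChart

variable {S : Set (EuclideanSpace ℝ (Fin 3))} {Pc : (EuclideanSpace ℝ (Fin 3)) → Finset (Fin 3 → ℤ)}
  {nb : (EuclideanSpace ℝ (Fin 3)) → (Fin 3 → ℤ) → (EuclideanSpace ℝ (Fin 3))}
  (hch : (∀ z ∈ S, (Pc z = fcc3Int ∨ Pc z = hcpInt) ∧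
      Set.BijOn (nb z) (↑(Pc z) : Set (Fin 3 → ℤ)) {y | y ∈ S ∧ (0 < dist z y ∧ dist z y ≤ 28 / 25)} ∧
      (∀ t ∈ Pc z, ∀ t' ∈ Pc z,
        ((0 < dist (nb z t) (nb z t') ∧ dist (nb z t) (nb z t') ≤ 28 / 25) ↔ sqNormInt (t - t') = 18))) ∧
    (∀ x ∈ S, ∀ y ∈ S, (0 < dist x y ∧ dist x y ≤ 28 / 25) →
      ∀ (z z' : EuclideanSpace ℝ (Fin 3)) (t t' u u' : Fin 3 → ℤ),
        ((t = 0 ∧ z = x) ∨ (t ∈ Pc x ∧ z = nb x t)) → ((t' = 0 ∧ z' = x) ∨ (t' ∈ Pc x ∧ z' = nb x t')) →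
        ((u = 0 ∧ z = y) ∨ (u ∈ Pc y ∧ z = nb y u)) → ((u' = 0 ∧ z' = y) ∨ (u' ∈ Pc y ∧ z' = nb y u')) →
        sqNormInt (u - u') = sqNormInt (t - t')))

include hch in
/-- **All layers of the development are valid and coherent**, and the letters match across
layers: the letter read below layer `n+1` is the parity of layer `n`, the parity of layer
`−(m+1)` is the letter read below layer `−m`. [folklore] -/
theorem layers {g₀ : ZFrame}
    (h₀ : IsFrame (Pc g₀.pt) g₀.t₁ g₀.t₂ g₀.U) (h₀S : g₀.pt ∈ S) (h₀p : frameParity g₀.t₁ g₀.t₂ g₀.U = 1)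
    (h₀A : (∀ z ∈ S, Pc z = fcc3Int) ∨ Pc g₀.pt = hcpInt) :
    (∀ k i j : ℤ, IsFrame (Pc (frameAt Pc nb g₀ k i j).pt) (frameAt Pc nb g₀ k i j).t₁ (frameAt Pc nb g₀ k i j).t₂
        (frameAt Pc nb g₀ k i j).U) ∧
    (∀ k i j : ℤ, (frameAt Pc nb g₀ k i j).pt ∈ S) ∧
    (∀ k i j : ℤ, frameAt Pc nb g₀ k (i + 1) j = Istep Pc nb (frameAt Pc nb g₀ k i j)) ∧
    (∀ k i j : ℤ, frameAt Pc nb g₀ k i (j + 1) = Jstep Pc nb (frameAt Pc nb g₀ k i j)) ∧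
    (∀ (n : ℕ) (i j : ℤ), lowerParity (frameAt Pc nb g₀ ((n : ℤ) + 1) i j).t₁ (frameAt Pc nb g₀ ((n : ℤ) + 1) i j).t₂
        (lowerCap (Pc (frameAt Pc nb g₀ ((n : ℤ) + 1) i j).pt) (frameAt Pc nb g₀ ((n : ℤ) + 1) i j).t₁
          (frameAt Pc nb g₀ ((n : ℤ) + 1) i j).t₂ (frameAt Pc nb g₀ ((n : ℤ) + 1) i j).U) =
        frameParity (frameAt Pc nb g₀ n i j).t₁ (frameAt Pc nb g₀ n i j).t₂ (frameAt Pc nb g₀ n i j).U) ∧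
    (∀ (m : ℕ) (i j : ℤ), frameParity (frameAt Pc nb g₀ (-((m : ℤ) + 1)) i j).t₁ (frameAt Pc nb g₀ (-((m : ℤ) + 1)) i j).t₂
        (frameAt Pc nb g₀ (-((m : ℤ) + 1)) i j).U =
        lowerParity (frameAt Pc nb g₀ (-(m : ℤ)) i j).t₁ (frameAt Pc nb g₀ (-(m : ℤ)) i j).t₂
          (lowerCap (Pc (frameAt Pc nb g₀ (-(m : ℤ)) i j).pt) (frameAt Pc nb g₀ (-(m : ℤ)) i j).t₁
            (frameAt Pc nb g₀ (-(m : ℤ)) i j).t₂ (frameAt Pc nb g₀ (-(m : ℤ)) i j).U)) := by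
  -- the layer predicate
  let OK : ℤ → Prop := fun k =>
    (∀ i j : ℤ, IsFrame (Pc (frameAt Pc nb g₀ k i j).pt) (frameAt Pc nb g₀ k i j).t₁ (frameAt Pc nb g₀ k i j).t₂
        (frameAt Pc nb g₀ k i j).U) ∧
    (∀ i j : ℤ, (frameAt Pc nb g₀ k i j).pt ∈ S) ∧
    (∀ i j : ℤ, frameAt Pc nb g₀ k (i + 1) j = Istep Pc nb (frameAt Pc nb g₀ k i j)) ∧
    (∀ i j : ℤ, frameAt Pc nb g₀ k i (j + 1) = Jstep Pc nb (frameAt Pc nb g₀ k i j))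
  have h0 : OK 0 := by
    obtain ⟨a, b, c, d, -⟩ := layer_zero (Pc := Pc) (nb := nb) hch h₀ h₀S h₀p h₀A
    exact ⟨a, b, c, d⟩
  have hup : ∀ n : ℕ, OK n → OK ((n : ℤ) + 1) ∧
      ∀ i j : ℤ, lowerParity (frameAt Pc nb g₀ ((n : ℤ) + 1) i j).t₁ (frameAt Pc nb g₀ ((n : ℤ) + 1) i j).t₂
        (lowerCap (Pc (frameAt Pc nb g₀ ((n : ℤ) + 1) i j).pt) (frameAt Pc nb g₀ ((n : ℤ) + 1) i j).t₁
          (frameAt Pc nb g₀ ((n : ℤ) + 1) i j).t₂ (frameAt Pc nb g₀ ((n : ℤ) + 1) i j).U) =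
        frameParity (frameAt Pc nb g₀ n i j).t₁ (frameAt Pc nb g₀ n i j).t₂ (frameAt Pc nb g₀ n i j).U := by
    rintro n ⟨a, b, c, d⟩
    obtain ⟨a', b', c', d', e'⟩ := layer_up hch (Φ := fun i j => frameAt Pc nb g₀ n i j) a b c d
    refine ⟨⟨fun i j => ?_, fun i j => ?_, fun i j => ?_, fun i j => ?_⟩, fun i j => ?_⟩
    · rw [frameAt_natSucc]; exact a' i j
    · rw [frameAt_natSucc]; exact b' i j
    · rw [frameAt_natSucc, frameAt_natSucc]; exact c' i j
    · rw [frameAt_natSucc, frameAt_natSucc]; exact d' i j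
    · rw [frameAt_natSucc]; exact e' i j
  have hdown : ∀ m : ℕ, OK (-(m : ℤ)) → OK (-((m : ℤ) + 1)) ∧
      ∀ i j : ℤ, frameParity (frameAt Pc nb g₀ (-((m : ℤ) + 1)) i j).t₁ (frameAt Pc nb g₀ (-((m : ℤ) + 1)) i j).t₂
        (frameAt Pc nb g₀ (-((m : ℤ) + 1)) i j).U =
        lowerParity (frameAt Pc nb g₀ (-(m : ℤ)) i j).t₁ (frameAt Pc nb g₀ (-(m : ℤ)) i j).t₂
          (lowerCap (Pc (frameAt Pc nb g₀ (-(m : ℤ)) i j).pt) (frameAt Pc nb g₀ (-(m : ℤ)) i j).t₁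
            (frameAt Pc nb g₀ (-(m : ℤ)) i j).t₂ (frameAt Pc nb g₀ (-(m : ℤ)) i j).U) := by
    rintro m ⟨a, b, c, d⟩
    obtain ⟨a', b', c', d', e'⟩ := layer_down hch (Φ := fun i j => frameAt Pc nb g₀ (-(m : ℤ)) i j) a b c d
    refine ⟨⟨fun i j => ?_, fun i j => ?_, fun i j => ?_, fun i j => ?_⟩, fun i j => ?_⟩
    · rw [frameAt_negSucc]; exact a' i j
    · rw [frameAt_negSucc]; exact b' i j
    · rw [frameAt_negSucc, frameAt_negSucc]; exact c' i j
    · rw [frameAt_negSucc, frameAt_negSucc]; exact d' i j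
    · rw [frameAt_negSucc]; exact e' i j
  have hnat : ∀ n : ℕ, OK n := by
    intro n; induction n with
    | zero => exact h0
    | succ m ih => have := (hup m ih).1; push_cast; exact this
  have hneg : ∀ m : ℕ, OK (-(m : ℤ)) := by
    intro m; induction m with
    | zero => simpa using h0
    | succ m ih => have := (hdown m ih).1; push_cast; exact this
  have hall : ∀ k : ℤ, OK k := by
    intro k
    rcases int_cases k with ⟨n, rfl⟩ | ⟨n, rfl⟩
    · exact hnat n
    · have := hneg (n + 1); push_cast at this; exact this
  exact ⟨fun k => (hall k).1, fun k => (hall k).2.1, fun k => (hall k).2.2.1, fun k => (hall k).2.2.2,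
    fun n => (hup n (hnat n)).2, fun m => (hdown m (hneg m)).2⟩

/-- Landing anchor of this helper file (registered on crux stmt-AtomisticToContinuum-13603 for the port of stub R1a4;
a label of the integer kissing pattern). [folklore] -/
theorem development_globalc_anchor : ![3, 0, 3] ∈ hcpInt := by decide

end Summit.AtomisticToContinuum.Crystallization.Theorems.PalmGoodLaw.Development

end
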